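import Summits.MatrixMultiplication.OmegaCensus.STPPKill223332332Z46KK

/-!
# ω-census (abelian STPP census): `{(2,2,3),(3,3,2),(3,3,2)}` in `ℤ/46ℤ` — a `K`-coset inside `Aᵢ` or `Bᵢ` forces `C_j` to be a `K`-coset (kernel)

HONEST FRAMING (pub-omega census; verbatim): lottery ticket; floor = certified bounds/negative ranges.
Census STRUCTURE (seat pub-omega-stpp-2 gen 32, 2026-08-30), family (b2); second clash file of HOME `pub-omega-stpp-2-g32/CASEMAP.md`.
A `13`-term progression of step `d` with `2d ≠ 0` never contains two elements differing by `23` (`not_mem_vadd23_of_apFinset`: index arithmetic, kernel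
decision).  Hence, for the two `(3,3,2)` blocks `i ≠ j` of an STPP family of the pattern in `ℤ/46ℤ`: if `Aᵢ` (or `Bᵢ`) contains a `K`-coset `{a, a + 23}`, then
`X_i = B_i − A_i ⊆ X°_j` contains two elements differing by `23`, so by `blockC_structure` the set `C_j` is NOT of progression type: **`C_j` is a `K`-coset**
(`coset_C_of_coset_A`, `coset_C_of_coset_B`); by `not_coset_coset` then `C_i` is not a `K`-coset, and therefore (same lemma with `i, j` exchanged) neither
`A_j` nor `B_j` contains a `K`-coset (`branch_of_coset`).  So the surviving branches of the case map are: all six small sets of progression type, or exactly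
one `C_j` a `K`-coset with `A_j, B_j, C_i` of progression type.  Nothing here is progress on `ω`.

References: H. Cohn, R. Kleinberg, B. Szegedy, C. Umans, FOCS 2005 (arXiv:math/0511460), Def. 5.1; Kemperman 1960 / Kneser 1953 (through the tools).
-/

open Finset
open scoped Pointwise

namespace Summit.MatrixMultiplication.OmegaCensus.Z46

open Literature.Computability.AlgebraicComplexity
open Literature.Combinatorics.Additive
open Summit.MatrixMultiplication.OmegaCensus.STPPKneser
open Summit.MatrixMultiplication.OmegaCensus.CubeNB

variable {A B C : Fin 3 → Finset (ZMod 46)}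

/-- Index arithmetic: for `2d ≠ 0`, no two terms of a `13`-term progression of step `d` differ by `23` (kernel decision). [folklore] -/
theorem nsmul_sub_nsmul_ne_23 : ∀ d : ZMod 46, 2 • d ≠ 0 → ∀ i < 13, ∀ l < 13, l • d - i • d ≠ 23 := by
  set_option maxRecDepth 100000 in decide +kernel

/-- A `13`-term progression of step `d`, `2d ≠ 0`, does not contain both `x` and `x + 23`. [folklore] -/
theorem not_mem_vadd23_of_apFinset {s d x : ZMod 46} (hd : 2 • d ≠ 0) (hx : x ∈ apFinset s d 13) (hx' : x + 23 ∈ apFinset s d 13) : False := by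
  rw [mem_apFinset] at hx hx'
  obtain ⟨i, hi, hxi⟩ := hx
  obtain ⟨l, hl, hxl⟩ := hx'
  apply nsmul_sub_nsmul_ne_23 d hd i hi l hl
  have : (s + l • d) - (s + i • d) = 23 := by rw [hxi, hxl]; abel
  rw [← this]; abel

/-- **If `X°_j` (`j = 1, 2`) contains `x` and `x + 23`, then `C_j` is a `K`-coset** (the progression alternative of `blockC_structure` is excluded).
[cite: Kemperman1960, Thm 2.1] [cite: CohnKleinbergSzegedyUmans2005, Def. 5.1] -/
theorem coset_C_of_pair23 (hS : IsSTPP A B C) (hA : ∀ i, #(A i) = ![2, 3, 3] i) (hB : ∀ i, #(B i) = ![2, 3, 3] i)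
    (hC : ∀ i, #(C i) = ![3, 2, 2] i) {j : Fin 3} (hj : j ≠ 0) {x : ZMod 46} (hx : x ∈ DU A B (univ.erase j))
    (hx' : x + 23 ∈ DU A B (univ.erase j)) : ∃ c : ZMod 46, C j = {c, c + 23} := by
  rcases blockC_structure hS hA hB hC j hj with ⟨d, hd, -, hap⟩ | h
  · exfalso
    have hCne : ∀ i, (C i).Nonempty := fun i => card_pos.1 (by rw [hC]; fin_cases i <;> simp)
    obtain ⟨s, hs⟩ := hap
    have h13 : #(DU A B (univ.erase j)) = 13 := by
      rw [card_DU_AB hS hCne]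
      fin_cases j <;> simp at hj ⊢ <;> simp only [hA, hB] <;> decide
    rw [h13] at hs
    rw [hs] at hx hx'
    exact not_mem_vadd23_of_apFinset hd hx hx'
  · exact h

/-- **A `K`-coset inside `Aᵢ` forces `C_j` (`j ≠ i`, both big blocks) to be a `K`-coset.** [cite: CohnKleinbergSzegedyUmans2005, Def. 5.1] -/
theorem coset_C_of_coset_A (hS : IsSTPP A B C) (hA : ∀ i, #(A i) = ![2, 3, 3] i) (hB : ∀ i, #(B i) = ![2, 3, 3] i)
    (hC : ∀ i, #(C i) = ![3, 2, 2] i) {i j : Fin 3} (hj : j ≠ 0) (hij : i ≠ j) (ha : ∃ a ∈ A i, a + 23 ∈ A i) :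
    ∃ c : ZMod 46, C j = {c, c + 23} := by
  obtain ⟨a, ha, ha'⟩ := ha
  have hBne : ∀ i, (B i).Nonempty := fun i => card_pos.1 (by rw [hB]; fin_cases i <;> simp)
  obtain ⟨b, hb⟩ := hBne i
  have hiJ : i ∈ univ.erase j := Finset.mem_erase.2 ⟨hij, Finset.mem_univ _⟩
  refine coset_C_of_pair23 hS hA hB hC hj (x := b - (a + 23)) ?_ ?_
  · exact Finset.mem_biUnion.2 ⟨i, hiJ, mem_D.2 ⟨a + 23, ha', b, hb, rfl⟩⟩
  · have e : b - (a + 23) + 23 = b - a := by abel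
    rw [e]; exact Finset.mem_biUnion.2 ⟨i, hiJ, mem_D.2 ⟨a, ha, b, hb, rfl⟩⟩

/-- **A `K`-coset inside `Bᵢ` forces `C_j` (`j ≠ i`, both big blocks) to be a `K`-coset.** [cite: CohnKleinbergSzegedyUmans2005, Def. 5.1] -/
theorem coset_C_of_coset_B (hS : IsSTPP A B C) (hA : ∀ i, #(A i) = ![2, 3, 3] i) (hB : ∀ i, #(B i) = ![2, 3, 3] i)
    (hC : ∀ i, #(C i) = ![3, 2, 2] i) {i j : Fin 3} (hj : j ≠ 0) (hij : i ≠ j) (hb : ∃ b ∈ B i, b + 23 ∈ B i) :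
    ∃ c : ZMod 46, C j = {c, c + 23} := by
  obtain ⟨b, hb, hb'⟩ := hb
  have hAne : ∀ i, (A i).Nonempty := fun i => card_pos.1 (by rw [hA]; fin_cases i <;> simp)
  obtain ⟨a, ha⟩ := hAne i
  have hiJ : i ∈ univ.erase j := Finset.mem_erase.2 ⟨hij, Finset.mem_univ _⟩
  refine coset_C_of_pair23 hS hA hB hC hj (x := b - a) ?_ ?_
  · exact Finset.mem_biUnion.2 ⟨i, hiJ, mem_D.2 ⟨a, ha, b, hb, rfl⟩⟩
  · have e : b - a + 23 = (b + 23) - a := by abel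
    rw [e]; exact Finset.mem_biUnion.2 ⟨i, hiJ, mem_D.2 ⟨a, ha, b + 23, hb', rfl⟩⟩

/-- `not_coset_coset` for the two big blocks in either order. [cite: CohnKleinbergSzegedyUmans2005, Def. 5.1] -/
theorem not_coset_coset' (hS : IsSTPP A B C) (hA : ∀ i, #(A i) = ![2, 3, 3] i) (hB : ∀ i, #(B i) = ![2, 3, 3] i)
    (hC : ∀ i, #(C i) = ![3, 2, 2] i) {i j : Fin 3} (hi : i ≠ 0) (hj : j ≠ 0) (hij : i ≠ j) {c c' : ZMod 46}
    (hci : C i = {c, c + 23}) (hcj : C j = {c', c' + 23}) : False := by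
  fin_cases i <;> fin_cases j <;> simp at hi hj hij
  · exact not_coset_coset hS hA hB hC hci hcj
  · exact not_coset_coset hS hA hB hC hcj hci

/-- **The branch with a `K`-coset inside `Aᵢ` or `Bᵢ`:** then `C_j` is a `K`-coset, `C_i` is not, and neither `A_j` nor `B_j` contains a `K`-coset — so by
`blockA/B/C_structure` the sets `A_j, B_j, C_i` are all of progression type. [cite: CohnKleinbergSzegedyUmans2005, Def. 5.1] [cite: Kemperman1960, Thm 2.1] -/
theorem branch_of_coset (hS : IsSTPP A B C) (hA : ∀ i, #(A i) = ![2, 3, 3] i) (hB : ∀ i, #(B i) = ![2, 3, 3] i)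
    (hC : ∀ i, #(C i) = ![3, 2, 2] i) {i j : Fin 3} (hi : i ≠ 0) (hj : j ≠ 0) (hij : i ≠ j)
    (h : (∃ a ∈ A i, a + 23 ∈ A i) ∨ (∃ b ∈ B i, b + 23 ∈ B i)) :
    (∃ c : ZMod 46, C j = {c, c + 23}) ∧ (¬ ∃ c : ZMod 46, C i = {c, c + 23}) ∧
      (¬ ∃ a ∈ A j, a + 23 ∈ A j) ∧ (¬ ∃ b ∈ B j, b + 23 ∈ B j) := by
  have hCj : ∃ c : ZMod 46, C j = {c, c + 23} :=
    h.elim (coset_C_of_coset_A hS hA hB hC hj hij) (coset_C_of_coset_B hS hA hB hC hj hij)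
  obtain ⟨c', hc'⟩ := hCj
  have hCi : ¬ ∃ c : ZMod 46, C i = {c, c + 23} := by
    rintro ⟨c, hc⟩
    exact not_coset_coset' hS hA hB hC hi hj hij hc hc'
  refine ⟨⟨c', hc'⟩, hCi, ?_, ?_⟩
  · intro hAj; exact hCi (coset_C_of_coset_A hS hA hB hC hi hij.symm hAj)
  · intro hBj; exact hCi (coset_C_of_coset_B hS hA hB hC hi hij.symm hBj)

end Summit.MatrixMultiplication.OmegaCensus.Z46
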